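import Literature.Analysis.Matrix.FiniteRangeDecompositionPowSymbolLower
import Mathlib.Algebra.Order.Field.GeomSum
import HarnessLib

/-!
# Finite-range decomposition with smoother pieces, IV: BLOCKS of scales (grouped pieces) — the
# regime bounds and the grouped Fourier lower bound

Buchholz groups the scales of Bauerschmidt's decomposition into blocks of ratio `L`: the `k`-th piece
`𝒞_k = ∫_{L^{k−1}/2R}^{L^k/2R} t W_t(𝒜) dt` collects all scales `t ∈ [L^{k−1}/2R, L^k/2R)`, and its
symbol obeys the REGIME BOUND (A.16) (three regimes `|p| ≥ L^{−(k−1)}` / `L^{−(k−1)} > |p| ≥ L^{−k}` /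
`|p| < L^{−k}`) and the LOWER bounds (A.28)/(A.29).  For the dyadic Fejér-power pieces
`C^{(m)}_N = frdPiecePow A m N` of `FiniteRangeDecompositionPow.lean` the block of scales
`N ∈ [N₀, N₁]` is the operator `Σ_{N=N₀}^{N₁} C^{(m)}_N`, and on the symbol side
(`a = σ_A(ψ) ∈ [0,4]`, `FiniteRangeDecompositionPowSymbol.lean`) we prove:

* `re_symbol_frdPow_identity`      : `a · Σ_{N<J} σ_{C^{(m)}_N}(ψ) + σ_{R^{(m)}_J}(ψ) = 1`
                                     (the symbol of `frdPow_identity`);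
* `sum_symbol_frdPiecePow_re_le_inv` : `Σ_{N∈[N₀,N₁]} σ_{C^{(m)}_N}(ψ) ≤ 1/a`            (middle regime);
* `sum_symbol_frdPiecePow_re_le_pow` : `Σ_{N∈[N₀,N₁]} σ_{C^{(m)}_N}(ψ) ≤ m 4^{N₁}/3`       (infrared regime,
                                     Buchholz's `C₀ L^{2k}/(8R²)` of (A.14));
* `sum_symbol_frdPiecePow_re_le_decay` : `Σ_{N∈[N₀,N₁]} σ_{C^{(m)}_N}(ψ) ≤ (m π^{2m+2}/3)/(a^{m+1} 4^{N₀ m})`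
                                     (ultraviolet regime, Buchholz's `C|p|⁻²(|p|L^{k−1})^{−(2n−2)}` of
                                     (A.13) with `n − 1 ↔ m`, `L^{k−1} ↔ 2^{N₀}`);
* `sum_symbol_frdPiecePow_re_ge_min` : for `a ≤ 4/4^{N₀}`, `0 < a`, `m ≥ 1`:
  `((4/π²)^{m+1}/4) · min(1/a, 4^{N₁}) ≤ Σ_{N∈[N₀,N₁]} σ_{C^{(m)}_N}(ψ)` — the grouped LOWER bound,
  Buchholz's (A.29) `𝒞̂_1(p) ≥ (ε/2) min(|p|⁻², L²/(4R²))` (first block: `N₀ = 0`, where `a ≤ 4`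
  always holds) and (A.28) for the later blocks.

[cite: Buchholz2016, App. A, (A.13)–(A.16) and (A.28)–(A.29) (form of the bounds)]; statements
[folklore] in the dyadic normalisation.
-/

noncomputable section

open Finset Real
open Literature.Analysis.Fourier Literature.Analysis.Fourier.TrigApprox

namespace Literature.Analysis.Matrix

variable {G : Type*} [AddCommGroup G] [Fintype G] [DecidableEq G]
variable {A : _root_.Matrix G G ℝ} (ψ : AddChar G ℂ)

/-! ## The decomposition identity on the symbol side -/

/-- **Symbol of the decomposition identity**: `σ_A(ψ) · Σ_{N<J} σ_{C^{(m)}_N}(ψ) + σ_{R^{(m)}_J}(ψ) = 1`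
(apply `symbol` to `A · Σ_{N<J} C^{(m)}_N + R^{(m)}_J = 1`).
[cite: Bauerschmidt2013, Thm. 1.2 (the decomposition identity, dyadic polynomial form)] -/
theorem symbol_frdPow_identity (hA : IsTranslationInvariant A) (m J : ℕ) :
    symbol A ψ * ∑ N ∈ Finset.range J, symbol (frdPiecePow A m N) ψ
        + symbol (frdRemainderPow A m J) ψ = 1 := by
  have h := congrArg (fun M => symbol M ψ) (frdPow_identity A m J)
  have hS : IsTranslationInvariant (∑ N ∈ Finset.range J, frdPiecePow A m N) :=
    IsTranslationInvariant.sum _ fun N _ => isTranslationInvariant_frdPiecePow hA m N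
  rwa [symbol_add, symbol_mul ψ _ hS, symbol_sum, symbol_one] at h

/-- Real form of the symbol identity: `a · Σ_{N<J} σ_{C^{(m)}_N}(ψ) + σ_{R^{(m)}_J}(ψ) = 1` with
`a = Re σ_A(ψ)` (all the piece symbols are real).
[cite: Bauerschmidt2013, Thm. 1.2 (the decomposition identity, dyadic polynomial form)] -/
theorem re_symbol_frdPow_identity (hA : IsTranslationInvariant A) (hs : A.IsHermitian)
    (h0 : A.PosSemidef) (h4 : ((4 : ℝ) • (1 : _root_.Matrix G G ℝ) - A).PosSemidef) (m J : ℕ) :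
    (symbol A ψ).re * ∑ N ∈ Finset.range J, (symbol (frdPiecePow A m N) ψ).re
        + (symbol (frdRemainderPow A m J) ψ).re = 1 := by
  have h := congrArg Complex.re (symbol_frdPow_identity ψ hA m J)
  have hreal : (∑ N ∈ Finset.range J, symbol (frdPiecePow A m N) ψ)
      = ((∑ N ∈ Finset.range J, (symbol (frdPiecePow A m N) ψ).re : ℝ) : ℂ) := by
    rw [Complex.ofReal_sum]
    refine Finset.sum_congr rfl fun N _ => ?_
    exact Complex.ext (by simp) (by simp [symbol_frdPiecePow_im ψ hA hs h0 h4 m N])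
  rw [hreal] at h
  simpa [Complex.add_re, Complex.re_mul_ofReal] using h

/-! ## Upper bounds for a block of scales (the regime bound) -/

/-- **Middle regime**: `Σ_{N∈[N₀,N₁]} σ_{C^{(m)}_N}(ψ) ≤ 1/a` for `a = σ_A(ψ) > 0` — from the identity
and `σ_{R} ≥ 0`, `σ_{C} ≥ 0` (the dyadic counterpart of the trivial bound `‖𝒞̂_k‖ ≤ ‖Â(p)⁻¹‖`, (A.15)).
[cite: Buchholz2016, App. A, (A.15) (form of the bound)] -/
theorem sum_symbol_frdPiecePow_re_le_inv (hA : IsTranslationInvariant A) (hs : A.IsHermitian)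
    (h0 : A.PosSemidef) (h4 : ((4 : ℝ) • (1 : _root_.Matrix G G ℝ) - A).PosSemidef) (m N₀ N₁ : ℕ)
    (ha : 0 < (symbol A ψ).re) :
    ∑ N ∈ Finset.Icc N₀ N₁, (symbol (frdPiecePow A m N) ψ).re ≤ 1 / (symbol A ψ).re := by
  have hid := re_symbol_frdPow_identity ψ hA hs h0 h4 m (N₁ + 1)
  have hR := symbol_frdRemainderPow_re_nonneg ψ hA hs h0 h4 m (N₁ + 1)
  have hsub : Finset.Icc N₀ N₁ ⊆ Finset.range (N₁ + 1) := by
    intro N hN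
    rw [Finset.mem_Icc] at hN
    exact Finset.mem_range.mpr (Nat.lt_succ_of_le hN.2)
  have hle : ∑ N ∈ Finset.Icc N₀ N₁, (symbol (frdPiecePow A m N) ψ).re
      ≤ ∑ N ∈ Finset.range (N₁ + 1), (symbol (frdPiecePow A m N) ψ).re :=
    Finset.sum_le_sum_of_subset_of_nonneg hsub
      fun N _ _ => symbol_frdPiecePow_re_nonneg ψ hA hs h0 h4 m N
  rw [le_div_iff₀ ha]
  nlinarith [Finset.sum_nonneg fun N (_ : N ∈ Finset.range (N₁ + 1)) =>
    symbol_frdPiecePow_re_nonneg ψ hA hs h0 h4 m N]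

/-- **Infrared regime**: `Σ_{N∈[N₀,N₁]} σ_{C^{(m)}_N}(ψ) ≤ m · 4^{N₁}/3` (each piece is at most
`m 4^N/4`; geometric sum) — the dyadic counterpart of (A.14) `≤ C₀ L^{2k}/(8R²)`.
[cite: Buchholz2016, App. A, (A.14) (form of the bound)] -/
theorem sum_symbol_frdPiecePow_re_le_pow (hA : IsTranslationInvariant A) (hs : A.IsHermitian)
    (h0 : A.PosSemidef) (h4 : ((4 : ℝ) • (1 : _root_.Matrix G G ℝ) - A).PosSemidef) (m N₀ N₁ : ℕ) :
    ∑ N ∈ Finset.Icc N₀ N₁, (symbol (frdPiecePow A m N) ψ).re ≤ m * 4 ^ N₁ / 3 := by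
  have hsub : Finset.Icc N₀ N₁ ⊆ Finset.range (N₁ + 1) := by
    intro N hN
    rw [Finset.mem_Icc] at hN
    exact Finset.mem_range.mpr (Nat.lt_succ_of_le hN.2)
  -- `Σ_{N ≤ N₁} 4^N = (4^{N₁+1} − 1)/3`
  have hgeom : ∑ N ∈ Finset.range (N₁ + 1), (4 : ℝ) ^ N = (4 ^ (N₁ + 1) - 1) / 3 := by
    have h := geom_sum_eq (x := (4 : ℝ)) (by norm_num) (N₁ + 1)
    rw [h]; norm_num
  calc ∑ N ∈ Finset.Icc N₀ N₁, (symbol (frdPiecePow A m N) ψ).re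
      ≤ ∑ N ∈ Finset.range (N₁ + 1), (symbol (frdPiecePow A m N) ψ).re :=
        Finset.sum_le_sum_of_subset_of_nonneg hsub
          fun N _ _ => symbol_frdPiecePow_re_nonneg ψ hA hs h0 h4 m N
    _ ≤ ∑ N ∈ Finset.range (N₁ + 1), (m : ℝ) * 4 ^ N / 4 :=
        Finset.sum_le_sum fun N _ => symbol_frdPiecePow_re_le ψ hA hs h0 h4 m N
    _ = (m : ℝ) / 4 * ∑ N ∈ Finset.range (N₁ + 1), (4 : ℝ) ^ N := by
        rw [Finset.mul_sum]
        refine Finset.sum_congr rfl fun N _ => ?_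
        ring
    _ = (m : ℝ) / 4 * ((4 ^ (N₁ + 1) - 1) / 3) := by rw [hgeom]
    _ ≤ m * 4 ^ N₁ / 3 := by
        have hm : (0 : ℝ) ≤ m := Nat.cast_nonneg m
        have h4 : (0 : ℝ) < 4 ^ N₁ := by positivity
        rw [pow_succ]
        nlinarith

/-- **Ultraviolet regime**: for `a = σ_A(ψ) > 0` and `m ≥ 1`,
`Σ_{N∈[N₀,N₁]} σ_{C^{(m)}_N}(ψ) ≤ (m π^{2m+2}/3) / (a^{m+1} 4^{N₀ m})` (each piece decays like
`a^{−(m+1)} 4^{−Nm}` above its shell; geometric sum from `N₀`) — the dyadic counterpart of (A.13)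
`≤ C|p|⁻²(|p|L^{k−1})^{−(2n−2)}`.  [cite: Buchholz2016, App. A, (A.13) (form of the bound)] -/
theorem sum_symbol_frdPiecePow_re_le_decay (hA : IsTranslationInvariant A) (hs : A.IsHermitian)
    (h0 : A.PosSemidef) (h4 : ((4 : ℝ) • (1 : _root_.Matrix G G ℝ) - A).PosSemidef) {m : ℕ}
    (hm : 1 ≤ m) (N₀ N₁ : ℕ) (ha : 0 < (symbol A ψ).re) :
    ∑ N ∈ Finset.Icc N₀ N₁, (symbol (frdPiecePow A m N) ψ).re
      ≤ m * π ^ (2 * m + 2) / 3 / ((symbol A ψ).re ^ (m + 1) * 4 ^ (N₀ * m)) := by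
  set a := (symbol A ψ).re with ha_def
  have hapow : 0 < a ^ (m + 1) := pow_pos ha _
  -- termwise decay bound, divided through by `a^{m+1}`
  have hterm : ∀ N, (symbol (frdPiecePow A m N) ψ).re
      ≤ m * π ^ (2 * m + 2) / (4 * a ^ (m + 1)) * ((1 / 4 ^ m) ^ N) := by
    intro N
    have h := symbol_frdPiecePow_re_mul_pow_le ψ hA hs h0 h4 m N
    rw [← ha_def] at h
    have h' : (symbol (frdPiecePow A m N) ψ).re ≤ m * π ^ (2 * m + 2) / (4 * 4 ^ (N * m)) / a ^ (m + 1) := by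
      rw [le_div_iff₀ hapow]; exact h
    calc (symbol (frdPiecePow A m N) ψ).re
        ≤ m * π ^ (2 * m + 2) / (4 * 4 ^ (N * m)) / a ^ (m + 1) := h'
      _ = m * π ^ (2 * m + 2) / (4 * a ^ (m + 1)) * ((1 / 4 ^ m) ^ N) := by
          rw [one_div_pow, ← pow_mul, mul_comm m N]
          field_simp
  -- geometric sum `Σ_{N ∈ [N₀,N₁]} (4^{−m})^N ≤ (4^{−m})^{N₀}/(1 − 4^{−m}) ≤ (4/3)·4^{−N₀ m}`
  have hx0 : (0 : ℝ) ≤ 1 / 4 ^ m := by positivity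
  have hx1 : (1 : ℝ) / 4 ^ m ≤ 1 / 4 := by
    apply div_le_div_of_nonneg_left (by norm_num) (by norm_num)
    calc (4 : ℝ) = 4 ^ 1 := by norm_num
      _ ≤ 4 ^ m := pow_le_pow_right₀ (by norm_num) hm
  have hx1' : (1 : ℝ) / 4 ^ m < 1 := by linarith
  have hgeom : ∑ N ∈ Finset.Icc N₀ N₁, ((1 : ℝ) / 4 ^ m) ^ N ≤ (1 / 4 ^ m) ^ N₀ * (4 / 3) := by
    rw [← Finset.Ico_add_one_right_eq_Icc]
    calc ∑ N ∈ Finset.Ico N₀ (N₁ + 1), ((1 : ℝ) / 4 ^ m) ^ N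
        ≤ (1 / 4 ^ m) ^ N₀ / (1 - 1 / 4 ^ m) := geom_sum_Ico_le_of_lt_one hx0 hx1'
      _ ≤ (1 / 4 ^ m) ^ N₀ / (3 / 4) := by
          apply div_le_div_of_nonneg_left (by positivity) (by norm_num)
          linarith
      _ = (1 / 4 ^ m) ^ N₀ * (4 / 3) := by ring
  have hC : 0 ≤ m * π ^ (2 * m + 2) / (4 * a ^ (m + 1)) := by positivity
  calc ∑ N ∈ Finset.Icc N₀ N₁, (symbol (frdPiecePow A m N) ψ).re
      ≤ ∑ N ∈ Finset.Icc N₀ N₁, m * π ^ (2 * m + 2) / (4 * a ^ (m + 1)) * ((1 / 4 ^ m) ^ N) :=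
        Finset.sum_le_sum fun N _ => hterm N
    _ = m * π ^ (2 * m + 2) / (4 * a ^ (m + 1)) * ∑ N ∈ Finset.Icc N₀ N₁, ((1 : ℝ) / 4 ^ m) ^ N := by
        rw [Finset.mul_sum]
    _ ≤ m * π ^ (2 * m + 2) / (4 * a ^ (m + 1)) * ((1 / 4 ^ m) ^ N₀ * (4 / 3)) :=
        mul_le_mul_of_nonneg_left hgeom hC
    _ = m * π ^ (2 * m + 2) / 3 / (a ^ (m + 1) * 4 ^ (N₀ * m)) := by
        rw [one_div_pow, ← pow_mul, mul_comm m N₀]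
        field_simp

/-! ## The grouped Fourier lower bound -/

/-- **Grouped lower bound** (dyadic (A.28)/(A.29)): if `0 < a = σ_A(ψ) ≤ 4/4^{N₀}`, `m ≥ 1` and
`N₀ ≤ N₁`, then `((4/π²)^{m+1}/4) · min(1/a, 4^{N₁}) ≤ Σ_{N∈[N₀,N₁]} σ_{C^{(m)}_N}(ψ)`:
either `a` lies below the whole block (`a ≤ 4/4^{N₁}`, the top piece alone gives `≍ 4^{N₁}`), or
`a` sits on the shell of some piece `N` of the block (`4/4^{N+1} < a ≤ 4/4^N`), which alone gives
`≍ 4^N ≥ 1/a`.  For the first block (`N₀ = 0`) the hypothesis `a ≤ 4` is automatic and this is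
Buchholz's `𝒞̂_1(p) ≥ (ε/2) min(|p|⁻², L²/(4R²))`.
[cite: Buchholz2016, App. A, (A.28)–(A.29) (form of the bound)] -/
theorem sum_symbol_frdPiecePow_re_ge_min (hA : IsTranslationInvariant A) (hs : A.IsHermitian)
    (h0 : A.PosSemidef) (h4 : ((4 : ℝ) • (1 : _root_.Matrix G G ℝ) - A).PosSemidef) {m : ℕ}
    (hm : 1 ≤ m) {N₀ N₁ : ℕ} (hN : N₀ ≤ N₁) (ha : 0 < (symbol A ψ).re)
    (hle : (symbol A ψ).re ≤ 4 / 4 ^ N₀) :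
    (4 / π ^ 2) ^ (m + 1) / 4 * min (1 / (symbol A ψ).re) (4 ^ N₁)
      ≤ ∑ N ∈ Finset.Icc N₀ N₁, (symbol (frdPiecePow A m N) ψ).re := by
  set a := (symbol A ψ).re with ha_def
  have hc : 0 ≤ (4 / π ^ 2) ^ (m + 1) / 4 := by positivity
  have hnonneg : ∀ N, 0 ≤ (symbol (frdPiecePow A m N) ψ).re :=
    fun N => symbol_frdPiecePow_re_nonneg ψ hA hs h0 h4 m N
  -- induction on the top scale `N₁ ≥ N₀`
  induction N₁, hN using Nat.le_induction with
  | base =>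
      -- the single piece `N₀`: `a ≤ 4/4^{N₀}` puts `ψ` on/below its shell
      rw [Finset.Icc_self, Finset.sum_singleton]
      calc (4 / π ^ 2) ^ (m + 1) / 4 * min (1 / a) (4 ^ N₀)
          ≤ (4 / π ^ 2) ^ (m + 1) / 4 * 4 ^ N₀ :=
            mul_le_mul_of_nonneg_left (min_le_right _ _) hc
        _ = 4 ^ N₀ * (4 / π ^ 2) ^ (m + 1) / 4 := by ring
        _ ≤ (symbol (frdPiecePow A m N₀) ψ).re := symbol_frdPiecePow_re_ge ψ hA hs h0 h4 hm N₀ hle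
  | succ N₁ hN₁ ih =>
      rw [Finset.sum_Icc_succ_top (Nat.le_succ_of_le hN₁)]
      by_cases hcase : a ≤ 4 / 4 ^ (N₁ + 1)
      · -- below the whole block: the top piece alone
        have htop := symbol_frdPiecePow_re_ge ψ hA hs h0 h4 hm (N₁ + 1) hcase
        have hrest : 0 ≤ ∑ N ∈ Finset.Icc N₀ N₁, (symbol (frdPiecePow A m N) ψ).re :=
          Finset.sum_nonneg fun N _ => hnonneg N
        calc (4 / π ^ 2) ^ (m + 1) / 4 * min (1 / a) (4 ^ (N₁ + 1))
            ≤ (4 / π ^ 2) ^ (m + 1) / 4 * 4 ^ (N₁ + 1) :=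
              mul_le_mul_of_nonneg_left (min_le_right _ _) hc
          _ = 4 ^ (N₁ + 1) * (4 / π ^ 2) ^ (m + 1) / 4 := by ring
          _ ≤ ∑ N ∈ Finset.Icc N₀ N₁, (symbol (frdPiecePow A m N) ψ).re
                + (symbol (frdPiecePow A m (N₁ + 1)) ψ).re := by linarith
      · -- `a > 4/4^{N₁+1} = 1/4^{N₁}`: then `1/a < 4^{N₁}`, both minima equal `1/a`, use the IH
        rw [not_le] at hcase
        have h4N : (0 : ℝ) < 4 ^ N₁ := by positivity
        have hinv : 1 / a < 4 ^ N₁ := by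
          have h41 : (4 : ℝ) / 4 ^ (N₁ + 1) = 1 / 4 ^ N₁ := by
            rw [pow_succ, div_mul_eq_div_div_swap]; norm_num
          rw [h41] at hcase
          exact (one_div_lt ha h4N).2 hcase
        have hmin1 : min (1 / a) ((4 : ℝ) ^ (N₁ + 1)) = 1 / a :=
          min_eq_left (by rw [pow_succ]; nlinarith)
        have hmin0 : min (1 / a) ((4 : ℝ) ^ N₁) = 1 / a := min_eq_left hinv.le
        rw [hmin1]
        rw [hmin0] at ih
        linarith [hnonneg (N₁ + 1)]

end Literature.Analysis.Matrix

end
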